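import Literature.NumberTheory.Sieve.FGKMT2018GoodPrimes
import Literature.NumberTheory.Sieve.FGKMT2018AssemblyKit
import HarnessLib

/-!
# Ford–Green–Konyagin–Maynard–Tao 2018 — §6, (6.15): the primes outside 𝒫(a⃗) contribute
# negligibly, in expectation over the uniform `a⃗` (PROVED, explicit constants)

Topic `Literature/NumberTheory/Sieve`. Source: K. Ford, B. Green, S. Konyagin, J. Maynard, T. Tao,
*Long gaps between primes*, J. Amer. Math. Soc. 31 (2018) 65–105 = arXiv:1412.5029, §6 p. 19
[FordGreenKonyaginMaynardTao2018]: «Next, we show that the set 𝒫(a⃗) may be replaced with 𝒫 with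
negligible effect. By Lemma 6.1 we have `E[Σ_h Σ_{p ∈ 𝒫} σ^{-r} Z_p(a⃗; n)] = (1 + O(1/log₂^{10} x)) |𝒫|`
and `E[Σ_h Σ_{p ∈ 𝒫(a⃗)} σ^{-r} Z_p(a⃗; n)] ≥ (1 − O(1/log³ x)) P(p ∈ 𝒫(a⃗)) |𝒫| = (1 − O(1/log³ x)) |𝒫|`
by Lemma 6.3; subtracting, we conclude that (6.15) `Σ_{p ∈ 𝒫 ∖ 𝒫(a⃗)} σ^{-r} X_p(a⃗) ≪ |𝒫|/log³ x`
in expectation. By Markov's inequality, (6.15) holds except with probability `O(log^{-1/2} x)`.»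

This file PROVES that expectation bound with explicit constants (`boxExp_badPrimes_Xp_le`:
`E Σ_{p ∈ 𝒫} X_p(a⃗) 1_{p ∉ 𝒫(a⃗)} ≤ |𝒫| σ^r (1/(1 − δ_r) − (1 − η)(1 − β))`, `β` the Lemma 6.3
exceptional measure of `FGKMT2018GoodPrimes.card_box_not_goodPrimes_le`), its Markov form
(`card_box_badPrimes_ge_le`), and the deterministic domination of the bad-prime part of the
covering sums by it (`sum_Zp_badPrimes_le`, from `FGKMT2018AssemblyKit.sum_Zp_shift_le`).
-/

noncomputable section

open Finset

namespace Literature.NumberTheory.Sieve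

namespace FGKMT2018

variable {x : ℕ} {H : Finset ℤ} {w : ℕ → ℤ → ℝ} {N : Finset ℤ}

/-- `E X_p(a⃗) ≤ σ^r/(1 − δ_r)` for `p ∈ 𝒫` (Lemma 6.1 upper bound, `Σ_n P(ñ_p = n) = 1`).
[cite: FordGreenKonyaginMaynardTao2018, (6.16) p. 18] -/
theorem boxExp_Xp_le (hS : ∀ s ∈ primesS x, s.Prime) {s₀ : ℕ} (hs₀ : 2 ≤ s₀)
    (hSs₀ : ∀ s ∈ primesS x, s₀ ≤ s) {p : ℕ} (hp : p ∈ primesHalf x) (hw : ∀ p n, 0 ≤ w p n)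
    (hNw : ∑ m ∈ N, w p m ≠ 0) {M : ℝ} (hM1 : 1 ≤ M)
    (hM : ∀ n ∈ N, ∀ n' ∈ N, ∀ h ∈ H, ∀ h' ∈ H,
      |((n + h * (p : ℤ) : ℤ) : ℝ) - ((n' + h' * (p : ℤ) : ℤ) : ℝ)| ≤ M)
    (hr : #H ≤ s₀) (hδ : (#H : ℝ) ^ 3 * Real.log M / (s₀ * Real.log s₀) < 1) :
    boxExp (primesS x) (fun f => Xp x (extendRes (primesS x) f) H w N p) ≤
      sigmaProd (primesS x) ^ #H / (1 - (#H : ℝ) ^ 3 * Real.log M / (s₀ * Real.log s₀)) := by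
  have hfun : (fun f : (s : ℕ) → s ∈ primesS x → ℕ => Xp x (extendRes (primesS x) f) H w N p) =
      Xlaw (primesS x) H p (lawTilde w N p) N := by
    funext f
    exact Xp_extendRes_eq H w N p f
  rw [hfun]
  have h := boxExp_Xlaw_le hS hs₀ hSs₀ (pos_of_mem_primesHalf hp).ne' (lam := lawTilde w N p)
    (fun n => lawTilde_nonneg hw N p n) hM1 hM hr hδ
  rwa [sum_lawTilde N p hNw, mul_one] at h

/-- **(6.15) in expectation, explicit**: with `X₀ = σ^r`, `𝒫(a⃗) = {p : |X_p(a⃗) − σ^r| ≤ η σ^r}`,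
`E Σ_{p ∈ 𝒫} X_p(a⃗) 1_{p ∉ 𝒫(a⃗)} ≤ |𝒫| · (σ^r/(1 − δ_r) − (1 − η) σ^r (1 − β))`, where
`β = ((1/(1 − δ_{2r}) − 2e^{-2r²Σ1/s²} + 1) + r² (W/T)/((1 − δ_{2r}) σ^r))/η²` is the exceptional measure
of Lemma 6.3 (`card_box_not_goodPrimes_le`), `δ_k = k³ log M/(s₀ log s₀)`.
[cite: FordGreenKonyaginMaynardTao2018, (6.15) p. 19] -/
theorem boxExp_badPrimes_Xp_le (hS : ∀ s ∈ primesS x, s.Prime) {s₀ : ℕ} (hs₀ : 2 ≤ s₀)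
    (hSs₀ : ∀ s ∈ primesS x, s₀ ≤ s) (hw : ∀ p n, 0 ≤ w p n) {W T : ℝ} (hW0 : 0 ≤ W)
    (hW : ∀ p n, w p n ≤ W) (hT : ∀ p ∈ primesHalf x, T ≤ ∑ m ∈ N, w p m) (hT0 : 0 < T)
    {M : ℝ} (hM1 : 1 ≤ M)
    (hM : ∀ p ∈ primesHalf x, ∀ n ∈ N, ∀ n' ∈ N, ∀ h ∈ H, ∀ h' ∈ H,
      |((n + h * (p : ℤ) : ℤ) : ℝ) - ((n' + h' * (p : ℤ) : ℤ) : ℝ)| ≤ M)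
    (h2r : 2 * #H ≤ s₀) (hδ₂ : (2 * (#H : ℝ)) ^ 3 * Real.log M / (s₀ * Real.log s₀) < 1)
    {η : ℝ} (hη : 0 < η) (hη1 : η ≤ 1) :
    boxExp (primesS x) (fun f => ∑ p ∈ primesHalf x,
        if p ∈ goodPrimes x (extendRes (primesS x) f) H w N (sigmaProd (primesS x) ^ #H) η then 0
        else Xp x (extendRes (primesS x) f) H w N p) ≤
      #(primesHalf x) * (sigmaProd (primesS x) ^ #H /
          (1 - (#H : ℝ) ^ 3 * Real.log M / (s₀ * Real.log s₀)) -
        (1 - η) * sigmaProd (primesS x) ^ #H *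
          (1 - ((1 / (1 - (2 * (#H : ℝ)) ^ 3 * Real.log M / (s₀ * Real.log s₀)) -
              2 * Real.exp (-(2 * (#H : ℝ) ^ 2 * ∑ s ∈ primesS x, 1 / (s : ℝ) ^ 2)) + 1) +
            (#H : ℝ) ^ 2 * (W / T) /
              ((1 - (2 * (#H : ℝ)) ^ 3 * Real.log M / (s₀ * Real.log s₀)) *
                sigmaProd (primesS x) ^ #H)) / η ^ 2)) := by
  classical
  have hS0 : ∀ s ∈ primesS x, 0 < s := fun s hs => (hS s hs).pos
  set S := primesS x with hSdef
  set σ := sigmaProd S with hσdef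
  set δ₁ : ℝ := (#H : ℝ) ^ 3 * Real.log M / (s₀ * Real.log s₀) with hδ₁def
  set δ₂ : ℝ := (2 * (#H : ℝ)) ^ 3 * Real.log M / (s₀ * Real.log s₀) with hδ₂def
  set β : ℝ := ((1 / (1 - δ₂) - 2 * Real.exp (-(2 * (#H : ℝ) ^ 2 * ∑ s ∈ S, 1 / (s : ℝ) ^ 2)) + 1) +
      (#H : ℝ) ^ 2 * (W / T) / ((1 - δ₂) * σ ^ #H)) / η ^ 2 with hβdef
  have hσ0 : 0 ≤ σ := sigmaProd_nonneg hS0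
  -- δ₁ ≤ δ₂ < 1
  have hs₀pos : (0 : ℝ) < s₀ := by exact_mod_cast (show 0 < s₀ by omega)
  have hlogs₀ : 0 < Real.log s₀ := Real.log_pos (by exact_mod_cast (show 1 < s₀ by omega))
  have hlogM : 0 ≤ Real.log M := Real.log_nonneg hM1
  have hδ₁ : δ₁ < 1 := by
    have : δ₁ ≤ δ₂ := by
      refine div_le_div_of_nonneg_right (mul_le_mul_of_nonneg_right ?_ hlogM)
        (mul_pos hs₀pos hlogs₀).le
      exact pow_le_pow_left₀ (Nat.cast_nonneg _) (by linarith [(Nat.cast_nonneg (#H) : (0:ℝ) ≤ #H)]) 3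
    linarith
  have hr : #H ≤ s₀ := le_trans (by omega) h2r
  rw [boxExp_sum]
  have hconst : ∀ X : ℝ, ∑ _p ∈ primesHalf x, X = #(primesHalf x) * X := fun X => by
    rw [Finset.sum_const, nsmul_eq_mul]
  rw [← hconst]
  refine Finset.sum_le_sum fun p hp => ?_
  have hNw : ∑ m ∈ N, w p m ≠ 0 := (lt_of_lt_of_le hT0 (hT p hp)).ne'
  refine boxExp_bad_part_le hS0
    (fun f => p ∈ goodPrimes x (extendRes S f) H w N (σ ^ #H) η)
    (boxExp_Xp_le hS hs₀ hSs₀ hp hw hNw hM1 (hM p hp) hr hδ₁)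
    (mul_nonneg (by linarith) (pow_nonneg hσ0 _))
    (fun f _ hgood => Xp_ge_of_mem_goodPrimes hgood) ?_
  exact card_box_not_goodPrimes_le hS hs₀ hSs₀ hp hw hW0 (hW p) (hT p hp) hT0 hM1 (hM p hp) h2r
    hδ₂ hη

/-- **Markov form of (6.15)**: the number of `a⃗` with `Σ_{p ∈ 𝒫 ∖ 𝒫(a⃗)} X_p(a⃗) ≥ t` is at most
`E[…]/t · ∏ s`. [cite: FordGreenKonyaginMaynardTao2018, (6.15) p. 19 («By Markov's inequality»)] -/
theorem card_box_badPrimes_ge_le (hS : ∀ s ∈ primesS x, 0 < s) (hw : ∀ p n, 0 ≤ w p n)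
    (X₀ η : ℝ) {t : ℝ} (ht : 0 < t) :
    (#((residueBox (primesS x)).filter fun f => t ≤ ∑ p ∈ primesHalf x,
        if p ∈ goodPrimes x (extendRes (primesS x) f) H w N X₀ η then 0
        else Xp x (extendRes (primesS x) f) H w N p) : ℝ) ≤
      boxExp (primesS x) (fun f => ∑ p ∈ primesHalf x,
        if p ∈ goodPrimes x (extendRes (primesS x) f) H w N X₀ η then 0
        else Xp x (extendRes (primesS x) f) H w N p) / t * ∏ s ∈ primesS x, (s : ℝ) := by
  refine card_box_filter_le hS _ (fun f _ => Finset.sum_nonneg fun p _ => ?_) ht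
  split_ifs
  · exact le_rfl
  · exact Xp_nonneg hw p

/-- **Deterministic domination**: for every `a⃗` and every finite set `Q'` of targets,
`Σ_{q ∈ Q'} Σ_h Σ_{p ∈ 𝒫 ∖ 𝒫(a⃗)} Z_p(a⃗; q − hp) ≤ r · Σ_{p ∈ 𝒫} X_p(a⃗) 1_{p ∉ 𝒫(a⃗)}`.
[cite: FordGreenKonyaginMaynardTao2018, (6.15) p. 19] -/
theorem sum_Zp_badPrimes_le {a : ℕ → ℕ} {X₀ η : ℝ} (hw : ∀ p n, 0 ≤ w p n)
    (hwN : ∀ p n, n ∉ N → w p n = 0) (Q' : Finset ℤ) :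
    ∑ q ∈ Q', ∑ h ∈ H, ∑ p ∈ (primesHalf x).filter (fun p => p ∉ goodPrimes x a H w N X₀ η),
        Zp x a H w N p (q - h * (p : ℤ)) ≤
      #H * ∑ p ∈ primesHalf x,
        (if p ∈ goodPrimes x a H w N X₀ η then 0 else Xp x a H w N p) := by
  refine (sum_Zp_shift_le hw hwN Q' _).trans (le_of_eq ?_)
  congr 1
  rw [Finset.sum_filter]
  refine Finset.sum_congr rfl fun p _ => ?_
  split_ifs <;> rfl

end FGKMT2018

end Literature.NumberTheory.Sieve
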